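import Mathlib.FieldTheory.IsAlgClosed.Basic
import Mathlib.GroupTheory.SpecificGroups.Cyclic.Basic
import Literature.NumberTheory.GaloisRepresentations.CliffordTwistOfRestriction
import Literature.NumberTheory.GaloisRepresentations.InducedGaloisRep
import HarnessLib

/-!
# An invariant irreducible representation of a normal subgroup of cyclic index extends

Topic `NumberTheory/GaloisRepresentations`; namespace
`Literature.NumberTheory.GaloisRepresentations`.  Theorems only: **no definition and no named
fact is introduced**.

Let `f : H →ₜ* G` be an open embedding of topological groups with normal image and CYCLIC
quotient `G / f(H)` (given as a surjection `q : G →* Q` onto a cyclic group with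
`q g = 1 ↔ g ∈ f(H)`), `A` an algebraically closed topological field, and `r : H →ₜ* GL_n(A)` an
IRREDUCIBLE framed continuous representation which is **stable under the outer action of `G`**:
for every `g ∈ G` the conjugate `h ↦ r (f⁻¹(g · f h · g⁻¹))` is isomorphic to `r` (a change of
frame `P · r · P⁻¹`).  Then `r` EXTENDS to `G`: there is a framed continuous representation
`R : G →ₜ* GL_n(A)` with `R ∘ f = r` on the nose (`FramedRep.exists_comp_eq_of_isCyclic`).

Proof (Clifford 1937, §§3–4; Isaacs, *Character theory of finite groups*, (11.22); the
obstruction to extending lies in `H²(G/f(H), Aˣ)`, which vanishes for a cyclic group acting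
trivially on the divisible group `Aˣ`).  Pick `τ₀ ∈ G` mapping to a generator of `Q`, of order
`d` in `Q` (`d = 0` allowed: infinite cyclic quotient), and `σ_d ∈ H` with `f σ_d = τ₀ ^ d`.
Stability at `τ₀` gives `B ∈ GL_n(A)` with `r(θ h) = B · r h · B⁻¹`, `θ h = f⁻¹(τ₀ f(h) τ₀⁻¹)`.
Both `B ^ d` and `r σ_d` implement `θ^d = Int(σ_d)` on the irreducible `r`, so `r(σ_d)⁻¹ B^d` is
a scalar `c₀` (Schur, `FramedRep.exists_eq_scalar_of_forall_commute`); replacing `B` by `c · B`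
with `c ^ d = c₀⁻¹` (`A` algebraically closed) achieves **`B ^ d = r σ_d`**
(`FramedRep.exists_conj_eq_and_pow_eq`).  Then `R (f h · τ₀ ^ k) := r h · B ^ k` (`k ∈ ℤ`) is
well defined (two such writings of one element differ by `k' = k + d m`, `h' = h σ_d^{-m}`),
multiplicative (`R (f h · g) = r h · R g`, `R (τ₀ · g) = B · R g`), and continuous because it is
a homomorphism of topological groups continuous on the open subgroup `f(H)`
(`FramedRep.exists_comp_eq_of_conj_of_pow_eq`,
`FramedRep.exists_comp_eq_of_forall_mem_range_iff`).

For a finite Galois extension of fields `M/F` of characteristic zero with `Gal(M/F)` cyclic and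
`f = absGaloisRestrict F M : Γ_M →ₜ* Γ_F` (an open embedding with normal image,
`isOpenEmbedding_absGaloisRestrict`, `conj_absGaloisRestrict_mem_range`; quotient map
`absGaloisQuot F M : Γ_F →* Gal(M/F)` with kernel `f(Γ_M)`, `absGaloisQuot_eq_one_iff`) this is
the classical statement that **an irreducible Galois representation `ρ'` of `Γ_M` whose
conjugates `ρ'^τ` (`FramedGaloisRep.outerConj`), `τ ∈ Γ_F`, are all isomorphic to `ρ'` is the
restriction of a Galois representation of `Γ_F`**
(`FramedGaloisRep.exists_restrictField_eq_of_forall_outerConj`) — the Galois side of cyclic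
(prime-degree) DESCENT: if `Π` is a cuspidal automorphic representation of `GL_n(𝔸_M)` with
`Π^σ ≅ Π` for `Gal(M/F) = ⟨σ⟩` of prime order, then `Π` is a base change from `F` (Arthur–Clozel
1989, Ch. 3, Thm. 4.2), and correspondingly its Galois representation, being `Γ_F`-stable,
descends to `Γ_F`.  The companion uniqueness statement (two descents differ by a character of
`Gal(M/F)`) is `FramedGaloisRep.exists_twist_of_restrictField_eq` (`CliffordTwistOfRestriction`).

## Main results

* `FramedRep.exists_conj_eq_and_pow_eq` — normalising the intertwiner: `B ^ d = r σ_d`.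
* `FramedRep.exists_comp_eq_of_conj_of_pow_eq` — the extension `R (f h · τ₀ ^ k) = r h · B ^ k`
  given a normalised intertwiner (any topological commutative ring `A`).
* `FramedRep.exists_comp_eq_of_forall_mem_range_iff`, `FramedRep.exists_comp_eq_of_isCyclic` —
  the abstract extension theorems (`A` an algebraically closed field, `r` irreducible).
* `FramedGaloisRep.exists_restrictField_eq_of_forall_outerConj` — the Galois form, `M/F` finite
  Galois with cyclic Galois group, characteristic zero.

Design notes.  The extension is an EQUALITY `R ∘ f = r` of framed representations, not merely an
isomorphism; cyclicity of the quotient is essential (for a general finite quotient the Schur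
multiplier obstruction need not vanish); `d = 0` (infinite cyclic quotient, e.g. `W_F ⊃ I_F`-type
situations) is allowed throughout and needs no root extraction.  Not here: the uniqueness up to
twist (`CliffordTwistOfRestriction`), and any automorphic statement.

## References

* A. H. Clifford, *Representations induced in an invariant subgroup*, Ann. of Math. 38 (1937),
  533–550, §§3–4. [Clifford1937]
* I. M. Isaacs, *Character theory of finite groups* (1976), Ch. 11, (11.22): an invariant
  irreducible character of `N ◁ G` with `G/N` cyclic extends to `G`. [Isaacs1976]
* J.-P. Serre, *Linear representations of finite groups*, GTM 42, §8.1.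
  [SerreLinearRepresentations1977]
* J. Arthur, L. Clozel, *Simple algebras, base change, and the advanced theory of the trace
  formula*, Ann. of Math. Stud. 120 (1989), Ch. 3, Thm. 4.2 and §6. [ArthurClozelAMS120]
-/

noncomputable section

open Topology

namespace Literature.NumberTheory.GaloisRepresentations

universe u u' v

section Abstract

variable {G : Type u} {H : Type u'} [Group G] [TopologicalSpace G] [IsTopologicalGroup G]
  [Group H] [TopologicalSpace H] {n : ℕ}

namespace FramedRep

section CommRing

variable {A : Type v} [CommRing A] [TopologicalSpace A] [IsTopologicalRing A]

/-- **The extension across `⟨f(H), τ₀⟩` given a normalised intertwiner.**  Let `f : H →ₜ* G` be an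
open embedding of topological groups, `τ₀ ∈ G`, `d : ℕ` and `σ_d ∈ H` with `f σ_d = τ₀ ^ d`, and
`θ : H → H` with `f (θ h) = τ₀ · f h · τ₀⁻¹`; assume every `g ∈ G` is `f h · τ₀ ^ k` (`k ∈ ℤ`) and
`τ₀ ^ k ∈ f(H) → d ∣ k`.  If `r : H →ₜ* GL_n(A)` and `B ∈ GL_n(A)` satisfy `r (θ h) = B · r h · B⁻¹`
and `B ^ d = r σ_d`, then `R (f h · τ₀ ^ k) := r h · B ^ k` is a well-defined framed continuous
representation of `G` extending `r`. [cite: Isaacs1976, (11.22)] -/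
theorem exists_comp_eq_of_conj_of_pow_eq (f : H →ₜ* G) (hf : IsOpenEmbedding f) (τ₀ : G) (d : ℕ)
    (σd : H) (hσd : f σd = τ₀ ^ d) (θ : H → H) (hθ : ∀ h, f (θ h) = τ₀ * f h * τ₀⁻¹)
    (hcover : ∀ g : G, ∃ (k : ℤ) (h : H), g = f h * τ₀ ^ k)
    (hmem : ∀ k : ℤ, τ₀ ^ k ∈ Set.range f → (d : ℤ) ∣ k)
    (r : FramedRep H A n) (B : GL (Fin n) A) (hB : ∀ h, r (θ h) = B * r h * B⁻¹)
    (hBd : B ^ d = r σd) :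
    ∃ R : FramedRep G A n, R.comp f = r := by
  have hfi : Function.Injective f := hf.injective
  choose k s hks using hcover
  have hpow : ∀ m : ℤ, f (σd ^ m) = τ₀ ^ ((d : ℤ) * m) := fun m => by
    rw [map_zpow, hσd, zpow_mul, zpow_natCast]
  -- the candidate extension, through the chosen writing `g = f (s g) · τ₀ ^ (k g)`
  let R : G → GL (Fin n) A := fun g => r (s g) * B ^ k g
  have hR : ∀ g, R g = r (s g) * B ^ k g := fun g => rfl
  -- KEY: `R` does not depend on the writing
  have key : ∀ (g : G) (h : H) (k₀ : ℤ), g = f h * τ₀ ^ k₀ → R g = r h * B ^ k₀ := by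
    intro g h k₀ hg
    have e : f (s g) * τ₀ ^ k g = f h * τ₀ ^ k₀ := (hks g).symm.trans hg
    have e1 : f ((s g)⁻¹ * h) = τ₀ ^ (k g - k₀) := by
      rw [map_mul, map_inv, zpow_sub]
      calc (f (s g))⁻¹ * f h = (f (s g))⁻¹ * (f h * τ₀ ^ k₀) * (τ₀ ^ k₀)⁻¹ := by group
        _ = (f (s g))⁻¹ * (f (s g) * τ₀ ^ k g) * (τ₀ ^ k₀)⁻¹ := by rw [e]
        _ = τ₀ ^ k g * (τ₀ ^ k₀)⁻¹ := by group
    obtain ⟨m, hm⟩ := hmem _ ⟨_, e1⟩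
    have hs : s g = h * (σd ^ m)⁻¹ := by
      have h2 : (s g)⁻¹ * h = σd ^ m := hfi (by rw [e1, hm, hpow])
      rw [← h2]; group
    have hk : k g = k₀ + (d : ℤ) * m := sub_eq_iff_eq_add'.mp hm
    rw [hR, hs, hk, map_mul, map_inv, map_zpow, ← hBd, zpow_add, zpow_mul, zpow_natCast]
    group
  have key' : ∀ (h : H) (k₀ : ℤ), R (f h * τ₀ ^ k₀) = r h * B ^ k₀ := fun h k₀ => key _ h k₀ rfl
  have hRf : ∀ h, R (f h) = r h := fun h => by
    have h1 := key' h 0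
    rwa [zpow_zero, zpow_zero, mul_one, mul_one] at h1
  -- left multiplication by `f h` and by `τ₀`
  have hRfh : ∀ (h : H) (g : G), R (f h * g) = r h * R g := fun h g => by
    calc R (f h * g) = R (f (h * s g) * τ₀ ^ k g) := by rw [map_mul, mul_assoc, ← hks g]
      _ = r h * R g := by rw [key', map_mul, mul_assoc, hR]
  have hRτ : ∀ g : G, R (τ₀ * g) = B * R g := fun g => by
    calc R (τ₀ * g) = R (f (θ (s g)) * τ₀ ^ (1 + k g)) := by
            rw [hθ, zpow_one_add]
            conv_lhs => rw [hks g]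
            congr 1
            group
      _ = B * R g := by rw [key', hB, hR, zpow_one_add]; group
  have hRτinv : ∀ g : G, R (τ₀⁻¹ * g) = B⁻¹ * R g := fun g => by
    have h1 := hRτ (τ₀⁻¹ * g)
    rw [mul_inv_cancel_left] at h1
    rw [h1, inv_mul_cancel_left]
  have hRτz : ∀ (m : ℤ) (g : G), R (τ₀ ^ m * g) = B ^ m * R g := by
    intro m
    induction m with
    | zero => intro g; rw [zpow_zero, zpow_zero, one_mul, one_mul]
    | succ i ih => intro g; rw [zpow_add_one, mul_assoc, ih, hRτ, zpow_add_one]; group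
    | pred i ih => intro g; rw [zpow_sub_one, mul_assoc, ih, hRτinv, zpow_sub_one]; group
  have hone : R 1 = 1 := by rw [← map_one f, hRf, map_one]
  have hmul : ∀ g₁ g₂ : G, R (g₁ * g₂) = R g₁ * R g₂ := fun g₁ g₂ => by
    calc R (g₁ * g₂) = R (f (s g₁) * (τ₀ ^ k g₁ * g₂)) := by rw [← mul_assoc, ← hks g₁]
      _ = R g₁ * R g₂ := by rw [hRfh, hRτz, hR g₁]; group
  let R₀ : G →* GL (Fin n) A := { toFun := R, map_one' := hone, map_mul' := hmul }
  -- continuity: a homomorphism of topological groups continuous on the open subgroup `f(H)`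
  have hcont : Continuous R₀ := by
    apply continuous_of_continuousAt_one R₀
    have h1 : ContinuousAt (R₀ ∘ f) 1 := by
      have h2 : (R₀ : G → GL (Fin n) A) ∘ f = r := funext hRf
      rw [h2]
      exact (map_continuous r).continuousAt
    have h3 := hf.continuousAt_iff.1 h1
    rwa [map_one] at h3
  exact ⟨{ toMonoidHom := R₀, continuous_toFun := hcont }, ContinuousMonoidHom.ext hRf⟩

end CommRing

section Field

variable {A : Type v} [Field A] [TopologicalSpace A] [IsTopologicalRing A]

omit [IsTopologicalGroup G] [IsTopologicalRing A] in
/-- **Normalising the intertwiner** (Schur).  With `f : H →ₜ* G` injective, `f σ_d = τ₀ ^ d`,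
`f (θ h) = τ₀ · f h · τ₀⁻¹`, `r : H →ₜ* GL_n(A)` irreducible over the algebraically closed field `A`
and `r (θ h) = B · r h · B⁻¹` for all `h`: both `B ^ d` and `r σ_d` implement `θ^d = Int(σ_d)` on
`r`, so `r(σ_d)⁻¹ · B ^ d` is a scalar `c₀` (`exists_eq_scalar_of_forall_commute`), and `c · B`
with `c ^ d = c₀⁻¹` is an intertwiner with `(c · B) ^ d = r σ_d`. [cite: Isaacs1976, (11.22)] -/
theorem exists_conj_eq_and_pow_eq [IsAlgClosed A] (f : H →ₜ* G) (hfi : Function.Injective f)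
    (τ₀ : G) (d : ℕ) (σd : H) (hσd : f σd = τ₀ ^ d) (θ : H → H)
    (hθ : ∀ h, f (θ h) = τ₀ * f h * τ₀⁻¹) (r : FramedRep H A n) (hirr : r.IsIrreducible)
    (B : GL (Fin n) A) (hB : ∀ h, r (θ h) = B * r h * B⁻¹) :
    ∃ B' : GL (Fin n) A, (∀ h, r (θ h) = B' * r h * B'⁻¹) ∧ B' ^ d = r σd := by
  rcases Nat.eq_zero_or_pos d with hd | hd
  · -- `d = 0`: `σ_d = 1` and `B` itself will do
    subst hd
    have hσ1 : σd = 1 := hfi (by rw [hσd, pow_zero, map_one])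
    exact ⟨B, hB, by rw [pow_zero, hσ1, map_one]⟩
  -- iterating the intertwining relation
  have hiter : ∀ (j : ℕ) (h : H), ∃ h' : H,
      f h' = τ₀ ^ j * f h * (τ₀ ^ j)⁻¹ ∧ r h' = B ^ j * r h * (B ^ j)⁻¹ := by
    intro j
    induction j with
    | zero => intro h; exact ⟨h, by group, by group⟩
    | succ j ih =>
      intro h
      obtain ⟨h', hf', hr'⟩ := ih h
      refine ⟨θ h', ?_, ?_⟩
      · rw [hθ, hf', pow_succ']; group
      · rw [hB, hr', pow_succ']; group
  -- `X := r(σ_d)⁻¹ B^d` commutes with `r(H)`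
  have hcomm : ∀ h : H, (r σd)⁻¹ * B ^ d * r h = r h * ((r σd)⁻¹ * B ^ d) := by
    intro h
    obtain ⟨h', hf', hr'⟩ := hiter d h
    have hh' : h' = σd * h * σd⁻¹ := hfi (by rw [hf', map_mul, map_mul, map_inv, hσd])
    rw [hh', map_mul, map_mul, map_inv] at hr'
    calc (r σd)⁻¹ * B ^ d * r h = (r σd)⁻¹ * (B ^ d * r h * (B ^ d)⁻¹) * B ^ d := by group
      _ = (r σd)⁻¹ * (r σd * r h * (r σd)⁻¹) * B ^ d := by rw [hr']
      _ = r h * ((r σd)⁻¹ * B ^ d) := by group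
  -- Schur: `X` is a (non-zero) scalar `c₀`
  obtain ⟨c₀, hc₀⟩ := exists_eq_scalar_of_forall_commute hirr
    (((r σd)⁻¹ * B ^ d : GL (Fin n) A) : Matrix (Fin n) (Fin n) A) fun h => by
      rw [← Units.val_mul, ← Units.val_mul, hcomm h]
  have hn : 0 < n := hirr.rank_pos
  haveI : Nonempty (Fin n) := ⟨⟨0, hn⟩⟩
  have hc₀0 : c₀ ≠ 0 := fun h0 => by
    have hdet := ((r σd)⁻¹ * B ^ d).isUnit.map Matrix.detMonoidHom
    rw [Matrix.coe_detMonoidHom, hc₀, h0, map_zero, Matrix.det_zero] at hdet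
    exact not_isUnit_zero hdet
  have hXs : (r σd)⁻¹ * B ^ d = scalar A n (Units.mk0 c₀ hc₀0) :=
    Units.ext (by rw [hc₀, coe_scalar_apply, Units.val_mk0])
  have hBd : B ^ d = r σd * scalar A n (Units.mk0 c₀ hc₀0) := by
    rw [← hXs, mul_inv_cancel_left]
  -- a `d`-th root of `c₀⁻¹`
  obtain ⟨c, hc⟩ := IsAlgClosed.exists_pow_nat_eq c₀⁻¹ hd
  have hc0 : c ≠ 0 := by
    rintro rfl
    rw [zero_pow hd.ne'] at hc
    exact inv_ne_zero hc₀0 hc.symm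
  have hcu : (Units.mk0 c hc0) ^ d = (Units.mk0 c₀ hc₀0)⁻¹ :=
    Units.ext (by rw [Units.val_pow_eq_pow_val, Units.val_mk0, hc, Units.val_inv_eq_inv_val,
      Units.val_mk0])
  refine ⟨scalar A n (Units.mk0 c hc0) * B, fun h => ?_, ?_⟩
  · rw [hB]
    symm
    calc scalar A n (Units.mk0 c hc0) * B * r h * (scalar A n (Units.mk0 c hc0) * B)⁻¹
        = scalar A n (Units.mk0 c hc0) * (B * r h * B⁻¹) * (scalar A n (Units.mk0 c hc0))⁻¹ := by
          group
      _ = B * r h * B⁻¹ * scalar A n (Units.mk0 c hc0) * (scalar A n (Units.mk0 c hc0))⁻¹ := by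
          rw [scalar_mul_comm _ (B * r h * B⁻¹)]
      _ = B * r h * B⁻¹ := by group
  · rw [(scalar_commute _ B).mul_pow, ← map_pow, hcu, hBd, map_inv, ← scalar_mul_comm _ (r σd),
      inv_mul_cancel_left]

/-- **Extension across a subgroup of cyclic index, coset form.**  Let `f : H →ₜ* G` be an open
embedding of topological groups, `τ₀ ∈ G` and `d : ℕ` with `G = ⋃_{k ∈ ℤ} f(H) · τ₀ ^ k`,
`τ₀ ^ k ∈ f(H) ↔ d ∣ k` and `τ₀ f(H) τ₀⁻¹ = f(H)` (through `θ : H → H`).  An irreducible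
`r : H →ₜ* GL_n(A)`, `A` an algebraically closed topological field, with `r ∘ θ ≅ r`
(`r (θ h) = B · r h · B⁻¹`) extends to `G`: `R ∘ f = r` for some `R : G →ₜ* GL_n(A)`.
[cite: Isaacs1976, (11.22)] -/
theorem exists_comp_eq_of_forall_mem_range_iff [IsAlgClosed A] (f : H →ₜ* G)
    (hf : IsOpenEmbedding f) (τ₀ : G) (d : ℕ) (θ : H → H)
    (hθ : ∀ h, f (θ h) = τ₀ * f h * τ₀⁻¹)
    (hcover : ∀ g : G, ∃ (k : ℤ) (h : H), g = f h * τ₀ ^ k)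
    (hmem : ∀ k : ℤ, τ₀ ^ k ∈ Set.range f ↔ (d : ℤ) ∣ k)
    (r : FramedRep H A n) (hirr : r.IsIrreducible)
    (B : GL (Fin n) A) (hB : ∀ h, r (θ h) = B * r h * B⁻¹) :
    ∃ R : FramedRep G A n, R.comp f = r := by
  obtain ⟨σd, hσd⟩ : ∃ σd : H, f σd = τ₀ ^ d := by
    obtain ⟨σd, h⟩ := (hmem d).2 dvd_rfl
    exact ⟨σd, by rw [h, zpow_natCast]⟩
  obtain ⟨B', hB', hBd'⟩ :=
    exists_conj_eq_and_pow_eq f hf.injective τ₀ d σd hσd θ hθ r hirr B hB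
  exact exists_comp_eq_of_conj_of_pow_eq f hf τ₀ d σd hσd θ hθ hcover (fun k hk => (hmem k).1 hk)
    r B' hB' hBd'

/-- **An invariant irreducible representation of an open normal subgroup with cyclic quotient
extends** (Clifford 1937, §§3–4; Isaacs (11.22)).  Let `f : H →ₜ* G` be an open embedding of
topological groups with normal image, `q : G →* Q` a surjection onto a cyclic group with
`q g = 1 ↔ g ∈ f(H)`, `A` an algebraically closed topological field and `r : H →ₜ* GL_n(A)`
irreducible such that for every `g ∈ G` the conjugate `h ↦ r(f⁻¹(g f(h) g⁻¹))` is a change of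
frame of `r`.  Then `R ∘ f = r` for some framed continuous representation `R` of `G`.
[cite: Isaacs1976, (11.22)] -/
theorem exists_comp_eq_of_isCyclic [IsAlgClosed A] (f : H →ₜ* G) (hf : IsOpenEmbedding f)
    (hnorm : ∀ (g : G) (h : H), ∃ h' : H, g * f h * g⁻¹ = f h')
    {Q : Type*} [Group Q] [IsCyclic Q] (q : G →* Q) (hqs : Function.Surjective q)
    (hq : ∀ g : G, q g = 1 ↔ g ∈ Set.range f)
    (r : FramedRep H A n) (hirr : r.IsIrreducible)
    (hstab : ∀ g : G, ∃ P : GL (Fin n) A, ∀ h h' : H,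
      f h' = g * f h * g⁻¹ → r h' = P * r h * P⁻¹) :
    ∃ R : FramedRep G A n, R.comp f = r := by
  obtain ⟨g₀, hg₀⟩ := IsCyclic.exists_generator (α := Q)
  obtain ⟨τ₀, hτ₀⟩ := hqs g₀
  choose θ hθ using hnorm τ₀
  obtain ⟨B, hB⟩ := hstab τ₀
  refine exists_comp_eq_of_forall_mem_range_iff f hf τ₀ (orderOf g₀) θ (fun h => (hθ h).symm)
    (fun g => ?_) (fun j => ?_) r hirr B fun h => hB h (θ h) (hθ h).symm
  · obtain ⟨j, hj⟩ := Subgroup.mem_zpowers_iff.1 (hg₀ (q g))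
    obtain ⟨h, hh⟩ : g * τ₀ ^ (-j) ∈ Set.range f := (hq _).1 (by
      rw [map_mul, map_zpow, hτ₀, ← hj, ← zpow_add, add_neg_cancel, zpow_zero])
    exact ⟨j, h, by rw [hh, zpow_neg, inv_mul_cancel_right]⟩
  · rw [← hq, map_zpow, hτ₀, orderOf_dvd_iff_zpow_eq_one]

end Field

end FramedRep

end Abstract

section Galois

open Field

variable {F M : Type} [Field F] [Field M] [Algebra F M] [IsGalois F M] [CharZero F] [CharZero M]
  [FiniteDimensional F M] [IsCyclic (M ≃ₐ[F] M)]
  {A : Type v} [Field A] [TopologicalSpace A] [IsTopologicalRing A] [IsAlgClosed A] {n : ℕ}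

/-- **A `Γ_F`-stable irreducible Galois representation of `Γ_M` descends to `Γ_F` when `Gal(M/F)`
is cyclic.**  Let `M/F` be a finite Galois extension of fields of characteristic zero with cyclic
Galois group, `A` an algebraically closed topological field, and `ρ' : Γ_M → GL_n(A)` an
irreducible framed Galois representation all of whose conjugates `ρ'^τ = ρ' ∘ θ_τ`
(`FramedGaloisRep.outerConj`, `τ ∈ Γ_F`) are isomorphic to `ρ'` (`P · ρ'^τ · P⁻¹ = ρ'`).  Then
`ρ' = ρ|_{Γ_M}` (`FramedGaloisRep.restrictField`, along `absGaloisRestrict F M`) for a framed Galois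
representation `ρ` of `Γ_F` — the Galois side of cyclic descent (Arthur–Clozel 1989, Ch. 3,
Thm. 4.2); `ρ` is unique up to the twists by characters of `Gal(M/F)`
(`FramedGaloisRep.exists_twist_of_restrictField_eq`). [cite: Isaacs1976, (11.22)] -/
theorem FramedGaloisRep.exists_restrictField_eq_of_forall_outerConj (ρ' : FramedGaloisRep M A n)
    (hirr : ρ'.IsIrreducible)
    (hstab : ∀ τ : absoluteGaloisGroup F, ∃ P : GL (Fin n) A,
      FramedRep.conj P (ρ'.outerConj τ) = ρ') :
    ∃ ρ : FramedGaloisRep F A n, ρ.restrictField M = ρ' := by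
  have hfi := absGaloisRestrict_injective F M
  refine FramedRep.exists_comp_eq_of_isCyclic (absGaloisRestrict F M)
    (isOpenEmbedding_absGaloisRestrict F M) (fun τ σ => ?_) (absGaloisQuot F M)
    (absGaloisQuot_surjective F M) (fun τ => ?_) ρ' hirr fun τ => ?_
  · obtain ⟨σ', h⟩ := conj_absGaloisRestrict_mem_range F M τ σ
    exact ⟨σ', h.symm⟩
  · rw [absGaloisQuot_eq_one_iff]
    rfl
  · obtain ⟨P, hP⟩ := hstab τ
    refine ⟨P⁻¹, fun σ σ' hσ' => ?_⟩
    have h1 : σ' = absGaloisOuterConj F M τ σ :=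
      hfi (by rw [hσ', absGaloisRestrict_absGaloisOuterConj])
    have h2 := congrArg (fun ρ : FramedGaloisRep M A n => ρ σ) hP
    simp only [FramedRep.conj_apply, FramedGaloisRep.outerConj_apply] at h2
    rw [h1, ← h2]
    group

end Galois

end Literature.NumberTheory.GaloisRepresentations

end
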